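import Summits.BirchSwinnertonDyer.BirchSwinnertonDyer.Theorems.CMKolyvaginAtInertTwoInertOrderSplittingH2
import Literature.NumberTheory.EllipticCurves.IsogenyDualProofs
import HarnessLib

/-!
# Route `CMKolyvaginAtInertTwo`, crux `CMKolyvaginExactAtInertTwo` (stmt-BirchSwinnertonDyer-24277):
# the inert-order splitting for the NON-MAXIMAL order `ℤ[3ζ₃]` (`j = −12288000`) — the CM generator
# `η = ψ ∘ ω ∘ φ` through ty2's kernel-`x` `3`-isogeny `φ` to a `j = 0` curve and its dual `ψ`
# (`η² + 9η = −27`), its Galois dichotomy, and the splitting package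

Seat `bsd-line-cmk2-p1` g10 (cell `bsd-print-cf2`); helper (`--supports stmt-BirchSwinnertonDyer-24277`).
THEOREMS ONLY: no definition, no named fact, no `sorry`; no item is closed; BSD is not proved by this.
Memo `Cruxes/CMExactDescentAtTwo/MEMO-inert-order-splitting.md` §5 (stub S3).

* §1 `exists_cmGenerator_baseChange_of_dichotomy` — `InertOrderSplittingHabitat.exists_cmGenerator_baseChange`
  with the CM generator given ABSTRACTLY by its relation `η₀² + mη₀ = c` (`m, c` odd) and its Galois
  DICHOTOMY over `ℚ` (every `γ ∈ Γ_ℚ` commutes with `η₀` or conjugates it to `η̄₀`), instead of Cox's `ι₀`.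
* §2 `rel_of_isogeny` / `dichotomy_of_isogeny` — pulling a generator `η'` of `E'` back along an isogeny
  `φ : E → E'` with `ψ φ = δ`: `η = ψ η' φ` satisfies `η² + δm'η = δ²c'` and inherits the dichotomy
  (`φ, ψ` are `Γ`-equivariant); `rel_of_addEquiv` / `dichotomy_of_addEquiv` — transport along an equivariant
  isomorphism of points (a `ℚ`-isomorphism of models).
* §3 `exists_cmGenerator_of_j_eq_neg_12288000` — for `j(E) = −12288000`: `E ≅ E_d = [0,36d,0,−48d²,16d³]`
  (ty2), Vélu's `φ : E_d → E'_d` (`j = 0`, `deg 3`), its dual `ψ` (`Isogeny.exists_dual_of_isElliptic`):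
  an `η₀` on `E(ℚ̄)` with `η₀² + 9η₀ = −27` (`2` inert in `ℤ[η₀] = ℤ[3ζ₃]`) and the dichotomy.
* §4 `exists_cmGenerator_splitting_of_cmInert_two` — the splitting package on ALL of `H₂`
  (`HasCM ∧ CMInert W 2 ∧ ρ̄₂ onto`, no restriction on `j`): `#S = (#S^{σ})²` for finite stable `S`.

References: Lang, *Elliptic Functions*, Ch. 10 §4 [Lang1987]; Vélu 1971 / Cremona §3.8 [CremonaAlgorithms1997];
Silverman *AEC* III.4, III.6 [SilvermanAEC2009]; Silverman *Advanced Topics* App. A §3 [SilvermanATAEC1994].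
-/

-- single-conjunct summit: `Summit.BirchSwinnertonDyer.BirchSwinnertonDyer.…` repeats the name by design
set_option linter.dupNamespace false
set_option autoImplicit false

noncomputable section

open scoped Classical

namespace Summit.BirchSwinnertonDyer.BirchSwinnertonDyer.Theorems.InertOrderSplittingHabitat

open WeierstrassCurve Field
open Literature.NumberTheory.EllipticCurves Literature.NumberTheory.EllipticCurves.Rank1Residual
open Literature.NumberTheory.GaloisRepresentations
open Summit.BirchSwinnertonDyer.Rank1Residual Summit.BirchSwinnertonDyer.Rank1Residual.P2
open Summit.BirchSwinnertonDyer.Rank1Residual.P2.CartanAtTwo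
open Summit.BirchSwinnertonDyer.BirchSwinnertonDyer.Theorems.KolyvaginEigenTwo

universe u

/-! ## §1 The equivariant generator over `K ∋ √Δ` from an abstract dichotomy -/

/-- **An equivariant CM generator over `K ∋ √Δ` from the dichotomy over `ℚ`.** If `η₀` on `E(ℚ̄)`
satisfies `η₀² + mη₀ = c` with `m, c` odd and every `γ ∈ Γ_ℚ` either commutes with `η₀` or conjugates
it to `η̄₀ = −η₀ − m`, then over any number field `K` with `Δ_E ∈ K^{×2}` the transport of `η₀` to
`E_K(K̄)` is `Γ_K`-equivariant (every `γ ∈ Γ_K` is even on `E[2]`, and even elements commute).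
[cite: Lang1987, Ch. 10 §4, Remark] -/
theorem exists_cmGenerator_baseChange_of_dichotomy (W : WeierstrassCurve ℚ) [W.IsElliptic]
    {η₀ : AddMonoid.End (geomPoints W)} {m c : ℤ}
    (hrel : ∀ P : geomPoints W, η₀ (η₀ P) + m • η₀ P = c • P) (hm : Odd m) (hc : Odd c)
    (hdich : ∀ γ : absoluteGaloisGroup ℚ, (∀ P : geomPoints W, γ • η₀ P = η₀ (γ • P)) ∨
      (∀ P : geomPoints W, η₀ (γ • P) = -(γ • η₀ P) - m • γ • P))
    (K : Type) [Field K] [NumberField K] (hΔ : IsSquare (W.baseChange K).Δ) :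
    ∃ η : AddMonoid.End (geomPoints (W.baseChange K)),
      (∀ P : geomPoints (W.baseChange K), η (η P) + m • η P = c • P) ∧
      (∀ (γ : absoluteGaloisGroup K) (P : geomPoints (W.baseChange K)), γ • η P = η (γ • P)) := by
  haveI : (W.baseChange K).IsElliptic := by rw [baseChange]; infer_instance
  have hcard : Nat.card (geomTorsion W ((2 : ℕ) : ℤ)) = 4 := by simpa using natCard_geomTorsion_two_pow W 1
  obtain ⟨e, he⟩ := WeierstrassCurve.exists_addEquiv_geomPoints_baseChange W K
  have he' : ∀ (γ : absoluteGaloisGroup K) (Q : geomPoints (W.baseChange K)),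
      e.symm (γ • Q) = absGaloisRestrict ℚ K γ • e.symm Q := fun γ Q ↦ by
    apply e.injective
    rw [he, AddEquiv.apply_symm_apply, AddEquiv.apply_symm_apply]
  refine ⟨(e : geomPoints W →+ geomPoints (W.baseChange K)).comp
      (η₀.comp (e.symm : geomPoints (W.baseChange K) →+ geomPoints W)), fun P ↦ ?_, fun γ P ↦ ?_⟩
  · change e (η₀ (e.symm (e (η₀ (e.symm P))))) + m • e (η₀ (e.symm P)) = c • P
    rw [AddEquiv.symm_apply_apply, ← map_zsmul, ← map_add, hrel, map_zsmul, AddEquiv.apply_symm_apply]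
  · change γ • e (η₀ (e.symm P)) = e (η₀ (e.symm (γ • P)))
    have h2K : (2 : K) ≠ 0 := two_ne_zero
    have hcomm : ∀ R : geomPoints W, absGaloisRestrict ℚ K γ • η₀ R = η₀ (absGaloisRestrict ℚ K γ • R) := by
      rcases smul_trivial_or_fixedPointFree_of_isSquare_Δ (W.baseChange K) h2K hΔ γ with htriv | hfpf
      · refine commute_of_trivial hm hcard (hdich _) fun R h2R ↦ ?_
        apply e.injective
        rw [he, htriv _ (by rw [← map_zsmul, h2R, map_zero])]
      · refine commute_of_fixedPointFree hrel hm hc hcard (hdich _) fun R h2R hfix ↦ ?_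
        have h : e R = 0 := hfpf (e R) (by rw [← map_zsmul, h2R, map_zero]) (by rw [← he, hfix])
        exact e.injective (by rw [h, map_zero])
    rw [← he, hcomm, ← he']

/-! ## §2 Pulling a generator back along an isogeny and along an isomorphism of points -/

section Isogeny

variable {k : Type u} [Field k] {V V' : WeierstrassCurve k} [V.IsElliptic] [V'.IsElliptic]

/-- **`η = ψ η' φ` satisfies `η² + δm'·η = δ²c'`** when `η'² + m'η' = c'`, `ψφ = δ` (hence `φψ = δ`,
`φ` onto). [cite: SilvermanAEC2009, III.6.1] -/
theorem rel_of_isogeny (φ : Isogeny V V') (ψ : Isogeny V' V) {δ : ℤ}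
    (hψφ : ∀ P : geomPoints V, ψ (φ P) = δ • P) {η' : AddMonoid.End (geomPoints V')} {m' c' : ℤ}
    (hrel' : ∀ Q : geomPoints V', η' (η' Q) + m' • η' Q = c' • Q) (P : geomPoints V) :
    ψ (η' (φ (ψ (η' (φ P))))) + (δ * m') • ψ (η' (φ P)) = (δ ^ 2 * c') • P := by
  have hφψ : ∀ Q : geomPoints V', φ (ψ Q) = δ • Q := fun Q ↦ by
    obtain ⟨P₀, rfl⟩ := φ.surjective Q
    rw [hψφ, map_zsmul]
  have h2 : η' (η' (φ P)) = c' • φ P - m' • η' (φ P) := eq_sub_of_add_eq (hrel' _)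
  rw [hφψ, map_zsmul, h2, map_zsmul, map_sub, map_zsmul, map_zsmul, hψφ]
  module

omit [V.IsElliptic] [V'.IsElliptic] in
/-- **The dichotomy pulls back along an isogeny defined over `k`**: `η = ψη'φ` commutes with `γ` when
`η'` does, and `η(γP) = −γ(ηP) − δm'·γP` when `η'(γQ) = −γ(η'Q) − m'·γQ`. [cite: Lang1987, Ch. 10 §4, Remark] -/
theorem dichotomy_of_isogeny (φ : Isogeny V V') (ψ : Isogeny V' V) {δ : ℤ}
    (hψφ : ∀ P : geomPoints V, ψ (φ P) = δ • P) {η' : AddMonoid.End (geomPoints V')} {m' : ℤ}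
    {γ : absoluteGaloisGroup k}
    (hdich' : (∀ Q : geomPoints V', γ • η' Q = η' (γ • Q)) ∨
      (∀ Q : geomPoints V', η' (γ • Q) = -(γ • η' Q) - m' • γ • Q)) :
    (∀ P : geomPoints V, γ • ψ (η' (φ P)) = ψ (η' (φ (γ • P)))) ∨
      (∀ P : geomPoints V, ψ (η' (φ (γ • P))) = -(γ • ψ (η' (φ P))) - (δ * m') • γ • P) := by
  rcases hdich' with h | h
  · left
    intro P
    rw [φ.map_smul, ← h, ψ.map_smul]
  · right
    intro P
    rw [φ.map_smul, h, map_sub, map_neg, ψ.map_smul, map_zsmul, ← φ.map_smul, hψφ, smul_smul,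
      mul_comm m' δ]

end Isogeny

section Transport

variable {k : Type u} [Field k] {W₁ W₂ : WeierstrassCurve k}

/-- A relation `η² + mη = c` transports along an additive isomorphism of points (`η ↦ e⁻¹ηe`). [folklore] -/
theorem rel_of_addEquiv (e : geomPoints W₁ ≃+ geomPoints W₂) {η : AddMonoid.End (geomPoints W₂)}
    {m c : ℤ} (hrel : ∀ Q : geomPoints W₂, η (η Q) + m • η Q = c • Q) (P : geomPoints W₁) :
    e.symm (η (e (e.symm (η (e P))))) + m • e.symm (η (e P)) = c • P := by
  rw [AddEquiv.apply_symm_apply, ← map_zsmul, ← map_add, hrel, map_zsmul, AddEquiv.symm_apply_apply]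

/-- The dichotomy transports along an EQUIVARIANT additive isomorphism of points. [folklore] -/
theorem dichotomy_of_addEquiv (e : geomPoints W₁ ≃+ geomPoints W₂)
    (he : ∀ (γ : absoluteGaloisGroup k) (P : geomPoints W₁), e (γ • P) = γ • e P)
    {η : AddMonoid.End (geomPoints W₂)} {m : ℤ} {γ : absoluteGaloisGroup k}
    (hdich : (∀ Q : geomPoints W₂, γ • η Q = η (γ • Q)) ∨
      (∀ Q : geomPoints W₂, η (γ • Q) = -(γ • η Q) - m • γ • Q)) :
    (∀ P : geomPoints W₁, γ • e.symm (η (e P)) = e.symm (η (e (γ • P)))) ∨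
      (∀ P : geomPoints W₁, e.symm (η (e (γ • P))) = -(γ • e.symm (η (e P))) - m • γ • P) := by
  have he' : ∀ (Q : geomPoints W₂), e.symm (γ • Q) = γ • e.symm Q := fun Q ↦ by
    apply e.injective; rw [he, AddEquiv.apply_symm_apply, AddEquiv.apply_symm_apply]
  rcases hdich with h | h
  · left
    intro P
    rw [he, ← h, he']
  · right
    intro P
    rw [he, h, map_sub, map_neg, he', map_zsmul, he', AddEquiv.symm_apply_apply]

end Transport

/-! ## §3 The order `ℤ[3ζ₃]`: `j = −12288000` -/

/-- **A CM generator with its dichotomy for `j(E) = −12288000`.** Every such `E/ℚ` is `ℚ`-isomorphic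
to `E_d = [0, 36d, 0, −48d², 16d³]` (ty2), which carries Vélu's `3`-isogeny `φ` to `E'_d` with `j = 0`;
with `ψ` the dual (`ψφ = 3`) and `ω` Cox's generator of `End E'_d = ℤ[ζ₃]` (`ω² + 3ω = −3`), the
endomorphism `η₀ = ψ ω φ` of `E(ℚ̄)` (transported along the isomorphism) satisfies **`η₀² + 9η₀ = −27`**
(`ℤ[η₀] ≅ ℤ[3ζ₃]`, `2` inert) and the Galois dichotomy with `η̄₀ = −η₀ − 9`.
[cite: Lang1987, Ch. 10 §4, Remark] [cite: CremonaAlgorithms1997, §3.8 (Vélu's formulae)] -/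
theorem exists_cmGenerator_of_j_eq_neg_12288000 (W : WeierstrassCurve ℚ) [W.IsElliptic]
    (hj : W.j = -12288000) :
    ∃ η₀ : AddMonoid.End (geomPoints W),
      (∀ P : geomPoints W, η₀ (η₀ P) + (9 : ℤ) • η₀ P = (-27 : ℤ) • P) ∧
      ∀ γ : absoluteGaloisGroup ℚ, (∀ P : geomPoints W, γ • η₀ P = η₀ (γ • P)) ∨
        (∀ P : geomPoints W, η₀ (γ • P) = -(γ • η₀ P) - (9 : ℤ) • γ • P) := by
  -- the reference model `E₁ = [0, 36, 0, -48, 16]`, `j = -12288000` (as in ty2's `smul_comm_of_j_eq_neg_12288000`)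
  haveI hE₁ : (⟨0, 36, 0, -48, 16⟩ : WeierstrassCurve ℚ).IsElliptic :=
    ⟨isUnit_iff_ne_zero.mpr (by
      norm_num [WeierstrassCurve.Δ, WeierstrassCurve.b₂, WeierstrassCurve.b₄, WeierstrassCurve.b₆,
        WeierstrassCurve.b₈])⟩
  have hjE₁ : (⟨0, 36, 0, -48, 16⟩ : WeierstrassCurve ℚ).j = -12288000 := by
    rw [j, Units.inv_mul_eq_iff_eq_mul, coe_Δ']
    norm_num [WeierstrassCurve.c₄, WeierstrassCurve.Δ, WeierstrassCurve.b₂, WeierstrassCurve.b₄,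
      WeierstrassCurve.b₆, WeierstrassCurve.b₈]
  obtain ⟨d, hd, C, hC⟩ := exists_variableChange_eq_quadraticTwist_of_j_eq
    (W := W) (E := (⟨0, 36, 0, -48, 16⟩ : WeierstrassCurve ℚ)) (by rw [hj, hjE₁])
    (by rw [hjE₁]; norm_num) (by rw [hjE₁]; norm_num)
  have hV : (⟨0, 36, 0, -48, 16⟩ : WeierstrassCurve ℚ).quadraticTwist d =
      ⟨0, 36 * d, 0, -48 * d ^ 2, 16 * d ^ 3⟩ := by
    ext <;> simp [WeierstrassCurve.quadraticTwist, WeierstrassCurve.b₂, WeierstrassCurve.b₄,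
      WeierstrassCurve.b₆] <;> ring
  rw [hV] at hC
  set V : WeierstrassCurve ℚ := ⟨0, 36 * d, 0, -48 * d ^ 2, 16 * d ^ 3⟩ with hVdef
  have hΔV : V.Δ = -995328 * d ^ 6 := by
    simp only [hVdef, WeierstrassCurve.Δ, WeierstrassCurve.b₂, WeierstrassCurve.b₄,
      WeierstrassCurve.b₆, WeierstrassCurve.b₈]
    ring
  have hΔV0 : V.Δ ≠ 0 := by rw [hΔV]; exact mul_ne_zero (by norm_num) (pow_ne_zero 6 hd)
  haveI hVell : V.IsElliptic := ⟨isUnit_iff_ne_zero.mpr hΔV0⟩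
  have hpair : IsKernelXThreePair (36 * d) (-48 * d ^ 2) (16 * d ^ 3) V
      (kernelXThreeCodomain (36 * d) (-48 * d ^ 2) (16 * d ^ 3)) :=
    isKernelXThreePair_mk (by ring) hΔV0
  set V' : WeierstrassCurve ℚ := kernelXThreeCodomain (36 * d) (-48 * d ^ 2) (16 * d ^ 3) with hV'def
  haveI hV'ell : V'.IsElliptic := ⟨isUnit_iff_ne_zero.mpr hpair.Δ'_ne⟩
  have hc4 : V'.c₄ = 0 := by
    simp only [hV'def, WeierstrassCurve.c₄, WeierstrassCurve.b₂, WeierstrassCurve.b₄,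
      kernelXThreeCodomain_a₁, kernelXThreeCodomain_a₂, kernelXThreeCodomain_a₃,
      kernelXThreeCodomain_a₄]
    ring
  have hjV' : V'.j = 0 := by rw [j, hc4]; ring
  -- Cox's generator `ω` on `V'` (`j = 0`, `d = -3`, `c = 3`): `ω² + 3ω = -3`
  obtain ⟨ω, hω, hωrel⟩ := exists_cmGenerator_of_mem_maximalCMJInvariants V'
    (by rw [hjV']; simp [maximalCMJInvariants]) (c := 3) (by rw [hjV']; norm_num [cmDiscr])
  have hdV' : cmDiscr V'.j = -3 := by rw [hjV']; norm_num [cmDiscr]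
  rw [hdV'] at hωrel
  have hrel' : ∀ Q : geomPoints V', ω (ω Q) + (3 : ℤ) • ω Q = (-3 : ℤ) • Q := by
    have h := rel_apply V' hωrel
    simpa using h
  -- Vélu's isogeny and its dual
  set φ := hpair.toIsogeny with hφ
  have hdeg : φ.degree = 3 := by
    rw [hφ]; exact hpair.natCard_ker_toIsogeny
  obtain ⟨ψ, hψ⟩ := Isogeny.exists_dual_of_isElliptic φ
  have hψφ : ∀ P : geomPoints V, ψ (φ P) = (3 : ℤ) • P := fun P ↦ by
    rw [hψ, hdeg]; norm_cast
  -- `η_V = ψ ω φ` on `V`, then transport to `W` along `C : W ≅ V`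
  set e := twistPointsIso hC with hedef
  refine ⟨(e.symm : geomPoints V →+ geomPoints W).comp
      ((ψ.toAddMonoidHom.comp (ω.comp φ.toAddMonoidHom)).comp (e : geomPoints W →+ geomPoints V)),
    fun P ↦ ?_, fun γ ↦ ?_⟩
  · have h := rel_of_addEquiv e (η := ψ.toAddMonoidHom.comp (ω.comp φ.toAddMonoidHom)) (m := 9) (c := -27)
      (fun Q ↦ by
        have h' := rel_of_isogeny φ ψ hψφ hrel' Q
        norm_num at h'
        exact h') P
    exact h
  · have h := dichotomy_of_addEquiv e (fun γ' P ↦ twistPointsIso_smul hC γ' P)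
      (η := ψ.toAddMonoidHom.comp (ω.comp φ.toAddMonoidHom)) (m := 9) (γ := γ)
      (by
        have h' := dichotomy_of_isogeny φ ψ hψφ (γ := γ) (dichotomy V' hω hωrel γ)
        norm_num at h'
        exact h')
    exact h

/-! ## §4 The splitting package on all of `H₂` -/

variable (W : WeierstrassCurve ℚ) [W.IsElliptic] {K : Type} [Field K] [NumberField K]
variable {σ : K ≃ₐ[ℚ] K} {c₀ : absoluteGaloisGroup ℚ}

/-- **THE SPLITTING PACKAGE ON `H₂` (all seven classes).** For `E/ℚ` with CM, `2` inert in the CM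
field `F` and `ρ̄_{E,2}` onto; `K` a number field containing `√d_F`; `σ ∈ Aut(K/ℚ)` an involution
lifted by the transport of a complex conjugation; `z ∈ Γ_K` without non-zero fixed point on `E_K[2]`:
there are odd `m, c` and a `Γ_K`-equivariant `η` on `E_K(K̄)` with `η² + mη = c` and restrictions `ηn`
to every `E_K[2^M]` such that every finite `σ_*`-, `η_*`-stable `S ≤ H¹(K, E_K[2^M])` has
`#S = (#S^{σ})²`. (`j ≠ −12288000`: `…InertOrderSplittingH2`; `j = −12288000`: §3 + §1.)
[cite: Lang1987, Ch. 10 §4, Remark] [cite: SilvermanATAEC1994, App. A §3] -/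
theorem exists_cmGenerator_splitting_of_cmInert_two (hCM : W.HasCM) (hin : CMInert W 2)
    (hsurj : W.HasSurjectiveModNGaloisRep 2) (hF : IsSquare (algebraMap ℚ K (cmFieldDiscrOfJ W.j)))
    (hc₀ : IsComplexConjugation (Rat.castHom ℝ) c₀) (hσ : σ * σ = 1)
    (hτ : IsLiftOfAut σ (absGaloisTransport (K := ℚ) (L := K) c₀).toRingEquiv)
    {z : absoluteGaloisGroup K}
    (hz : ∀ P : geomPoints (W.baseChange K), (2 : ℤ) • P = 0 → z • P = P → P = 0) :
    ∃ (m c : ℤ) (η : AddMonoid.End (geomPoints (W.baseChange K))), Odd m ∧ Odd c ∧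
      (∀ P : geomPoints (W.baseChange K), η (η P) + m • η P = c • P) ∧
      (∀ (γ : absoluteGaloisGroup K) (P : geomPoints (W.baseChange K)), γ • η P = η (γ • P)) ∧
      ∀ M : ℕ, ∃ ηn : geomTorsion (W.baseChange K) ((2 : ℤ) ^ M) →+ geomTorsion (W.baseChange K) ((2 : ℤ) ^ M),
        ∃ hηnG : ∀ (x : absoluteGaloisGroup K) (P : geomTorsion (W.baseChange K) ((2 : ℤ) ^ M)),
            ηn (ContinuousMonoidHom.id (absoluteGaloisGroup K) x • P) = x • ηn P,
          (∀ P : geomTorsion (W.baseChange K) ((2 : ℤ) ^ M), (ηn P : geomPoints (W.baseChange K)) = η P) ∧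
          ∀ S : AddSubgroup (galH1Torsion (W.baseChange K) ((2 : ℤ) ^ M)),
            (∀ x ∈ S, conjAct W σ _ x ∈ S) →
            (∀ x ∈ S, resH1Hom (ContinuousMonoidHom.id _) ηn hηnG x ∈ S) →
              Nat.card S =
                Nat.card {x : S // conjAct W σ _ (x : galH1Torsion (W.baseChange K) ((2 : ℤ) ^ M)) = x} ^ 2 := by
  by_cases hj12 : W.j = -12288000
  · have hΔ : W.Δ < 0 := Δ_neg_of_cmInert_two W hCM hin hsurj
    have hΔK : IsSquare (W.baseChange K).Δ := isSquare_Δ_baseChange_of_isSquare_cmFieldDiscr W K hCM hin hsurj hF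
    obtain ⟨η₀, hrel₀, hdich⟩ := exists_cmGenerator_of_j_eq_neg_12288000 W hj12
    obtain ⟨η, hrel, hη⟩ := exists_cmGenerator_baseChange_of_dichotomy W hrel₀ (by decide) (by decide) hdich K hΔK
    refine ⟨9, -27, η, by decide, by decide, hrel, hη, fun M ↦ ?_⟩
    obtain ⟨ηn, hηn, hηnG⟩ := exists_torsionRestrict (W.baseChange K) η hη ((2 : ℤ) ^ M)
    refine ⟨ηn, hηnG, hηn, fun S hSσ hSη ↦ ?_⟩
    have hrel' : ∀ P : geomPoints (W.baseChange K), η (η P) + (2 * (4 : ℤ) + 1) • η P = (-27 : ℤ) • P := by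
      intro P; norm_num; exact hrel P
    exact natCard_stable_eq_sq_of_complexConjugation W hΔ hc₀ hσ hτ hrel' (by decide) hη hz M ηn hηn hηnG S hSσ hSη
  · exact exists_cmGenerator_splitting_of_habitat W hCM hin hsurj hj12 hF hc₀ hσ hτ hz

end Summit.BirchSwinnertonDyer.BirchSwinnertonDyer.Theorems.InertOrderSplittingHabitat
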